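import Summits.CriticalPhenomena.SAWScalingLimit.Theorems.SAWRenewalTightnessTubeLowerBoundCornerStaircaseHelpers
import Summits.CriticalPhenomena.SAWScalingLimit.Theorems.SAWRenewalTightnessTubeLowerBoundDoublingUpgrade

/-!
# Crux `TubeLowerBound` (stmt-CriticalPhenomena-4730), line `subcritical-renewal-floor`: stub S5 `stub_coneToDiamond`

`stub_coneToDiamond : ConeBridgeFloor → DiamondPieceFloor` (both inlined; lead c3's reshape of the planner's
`staircaseAssembly`).  The hypothesis is a polynomial floor `c s^{-C}` for the `x_c`-mass of CONE BRIDGES: bridges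
`ω : 0 → (s, t)` (`0 < x(i) ≤ s` at times `i ≥ 1`, `Zd.IsBridge`) inside the tube `|y − (t/s) x| ≤ κ s/4 + 1` and the
END CONE `4|y(i) − t| ≤ s − x(i)`; any witness has `κ ≤ 1/4` (`Negative.coneBridgeFloor_kappa_le`).  The conclusion
is the DIAMOND-PIECE floor of the sibling line `bridge-doubling-tower` (verbatim the hypothesis of the landed
`BridgeDoublingTower.stub_diamondStaircase`): self-avoiding walks `0 → (s, 0)` whose points at interior times
`1 ≤ i < n` satisfy `|y| < x`, `|y| < s − x`, and all of whose points satisfy `10|y| ≤ s`.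

Proof.  Only `t = 0` is used.  For `s ≥ 16` write `s = s₁ + s₂`, `s₂ = ⌊s/2⌋ ≥ 8`, `s₂ ≤ s₁ ≤ s₂ + 1`.
* FIRST HALF = CO-BRIDGE (`coneMass_le_coBridgeMass`): a cone bridge `β : 0 → (s₁, 0)` rotated by `π` and run
  backwards, `υ(i) = (s₁, 0) − β(n − i)`, is a self-avoiding walk `0 → (s₁, 0)` (`coBridge_mem_sawFun`) whose
  points satisfy the START-cone site predicate `0 ≤ x ≤ s₁`, `4|y| ≤ x`, `16|y| ≤ s₁ + 16` (the last from the real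
  tube bound and `κ ≤ 1/4`, `sixteen_mul_abs_le`); `β ↦ υ` is injective, so this family has mass `≥ c s₁^{-C}`.
* SECOND HALF (`coneMass_le_endConeMass`): cone bridges `0 → (s₂, 0)` lie in the family of self-avoiding walks
  `0 → (s₂, 0)` with the END-cone site predicate `x > 0` or the origin, `4|y| ≤ s₂ − x`, `16|y| ≤ s₂ + 16`.
* GLUE (`CornerStaircase.tubeMass_concat`): the first family lives in the columns `x ≤ s₁`, the translate of the
  second in `x > s₁` apart from its first point, so concatenation at `(s₁, 0)` is self-avoiding and lands in the
  DIAMOND site predicate "`(0,0)`, `(s,0)` or `|y| < min(x, s − x)`; and `10|y| ≤ s`"; masses multiply: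
  `≥ c² (s₁ s₂)^{…} ≥ c² s^{-2 max(C,0)}`.
* A walk of that family is a diamond piece (`diamondMass_le`): at interior times it is neither `0 = ω(0)` nor
  `(s, 0) = ω(n)` by self-avoidance.
For `1 ≤ s < 16` the straight walk (`BridgeDoublingTower.doubling_straight_term`) has mass `x_c^s ≥ x_c^16`.
Constants: `C' = 2 max(C, 0)`, `c' = min(c², x_c^16)`, cut-off `N₁ + N₂` (resp. `s`).
-/

noncomputable section

namespace Summit.CriticalPhenomena.SAWScalingLimit.Theorems.TubeLowerBound.SubcriticalRenewalFloor

open scoped BigOperators Classical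
open Literature.Probability.LatticeModels
open Literature.Probability.RandomPlanarGeometry Literature.Probability.RandomPlanarGeometry.SAW

namespace ConeToDiamond

open Literature.Probability.Percolation.Contour (site_ext)

/-! ### The co-bridge: rotation by `π` and time reversal -/

/-- **Co-bridge.**  If `ω` is an `n`-step self-avoiding walk `0 → e`, then so is `i ↦ e − ω (n − i)` (rotation by `π`
about `e/2` composed with time reversal: nearest-neighbour steps and self-avoidance are preserved, the endpoints are
exchanged and mapped onto each other). -/
theorem coBridge_mem_sawFun {n : ℕ} {e : Site 2} {ω : ℕ → Site 2} (h : ω ∈ Zd.sawFun 2 n e) :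
    (fun i => e - ω (n - i)) ∈ Zd.sawFun 2 n e := by
  obtain ⟨h0, hend, hadj, hinj⟩ := Zd.mem_sawFun.1 h
  refine Zd.mem_sawFun.2 ⟨?_, fun i hi => ?_, fun i hi => ?_, fun i hi j hj hij => ?_⟩
  · simp only [Nat.sub_zero, hend n le_rfl, sub_self]
  · simp only [Nat.sub_eq_zero_of_le hi, h0, sub_zero]
  · obtain ⟨k, hk⟩ := (Zd.zdGraph_adj_iff_sub _ _).1 (hadj (n - (i + 1)) (by omega))
    rw [show n - (i + 1) + 1 = n - i by omega] at hk
    rw [Zd.zdGraph_adj_iff_sub]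
    refine ⟨k, ?_⟩
    simpa only [sub_sub_sub_cancel_left] using hk
  · simp only [Set.mem_setOf_eq] at hi hj
    have hij' : ω (n - i) = ω (n - j) := sub_right_inj.1 hij
    have := hinj (show n - i ≤ n from Nat.sub_le n i) (show n - j ≤ n from Nat.sub_le n j) hij'
    omega

/-- An injection between two families of walks compares their masses at a fixed length. -/
theorem sum_le_sum_of_injOn {A B : Finset (ℕ → Site 2)} (φ : (ℕ → Site 2) → ℕ → Site 2)
    (hmaps : ∀ ω ∈ A, φ ω ∈ B) (hinj : Set.InjOn φ A) (n : ℕ) :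
    (∑ _ω ∈ A, criticalFugacity ^ n) ≤ ∑ _ω ∈ B, criticalFugacity ^ n := by
  rw [Finset.sum_const, Finset.sum_const, nsmul_eq_mul, nsmul_eq_mul]
  refine mul_le_mul_of_nonneg_right ?_ (pow_nonneg criticalFugacity_pos.le n)
  exact_mod_cast Finset.card_le_card_of_injOn φ
    (fun ω hω => Finset.mem_coe.2 (hmaps ω (Finset.mem_coe.1 hω))) hinj

/-- The real tube bound at `t = 0`, `|y| ≤ κ s/4 + 1` with `κ ≤ 1/4`, in integers: `16|y| ≤ s + 16`. -/
theorem sixteen_mul_abs_le {κ : ℝ} (hκ : κ ≤ 1 / 4) {s : ℕ} {x y : ℤ}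
    (h : |((y : ℤ) : ℝ) - ((0 : ℤ) : ℝ) / (s : ℝ) * ((x : ℤ) : ℝ)| ≤ κ * s / 4 + 1) :
    16 * |y| ≤ (s : ℤ) + 16 := by
  simp only [Int.cast_zero, zero_div, zero_mul, sub_zero] at h
  have hs : (0 : ℝ) ≤ s := Nat.cast_nonneg s
  have h1 : κ * s ≤ 1 / 4 * s := mul_le_mul_of_nonneg_right hκ hs
  have h2 : ((16 * |y| : ℤ) : ℝ) ≤ (((s : ℤ) + 16 : ℤ) : ℝ) := by
    push_cast
    linarith
  exact_mod_cast h2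

/-! ### The two halves -/

/-- **First half: co-bridges.**  The cone-bridge mass at `(s, 0)` is at most the mass of self-avoiding walks
`0 → (s, 0)` confined by the START-cone site predicate `0 ≤ x ≤ s`, `4|y| ≤ x`, `16|y| ≤ s + 16`: the co-bridge
of a cone bridge is such a walk (bridge: `0 < x ≤ s` after time `0`; end cone `4|y| ≤ s − x`; tube), injectively. -/
theorem coneMass_le_coBridgeMass {κ : ℝ} (hκ : κ ≤ 1 / 4) (s : ℕ) {t : ℤ} (ht : t = 0) (N : ℕ) :
    (∑ n ∈ Finset.range (N + 1),
      ∑ _ω ∈ (Zd.bridges 2 n).filter (fun ω => ω n = ![(s : ℤ), t] ∧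
          ∀ i ≤ n, |((ω i 1 : ℤ) : ℝ) - (t : ℝ) / (s : ℝ) * ((ω i 0 : ℤ) : ℝ)| ≤ κ * s / 4 + 1 ∧
            4 * |ω i 1 - t| ≤ (s : ℤ) - ω i 0),
        criticalFugacity ^ n) ≤
      ∑ n ∈ Finset.range (N + 1),
        ∑ _ω ∈ (Zd.sawFun 2 n ![(s : ℤ), 0]).filter (fun ω => ∀ i ≤ n,
            0 ≤ ω i 0 ∧ ω i 0 ≤ (s : ℤ) ∧ 4 * |ω i 1| ≤ ω i 0 ∧ 16 * |ω i 1| ≤ (s : ℤ) + 16),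
          criticalFugacity ^ n := by
  subst ht
  refine Finset.sum_le_sum fun n _ => sum_le_sum_of_injOn (fun ω i => ![(s : ℤ), 0] - ω (n - i))
    (fun ω hω => ?_) ?_ n
  · rw [Finset.mem_filter] at hω ⊢
    obtain ⟨hωb, hωn, hcone⟩ := hω
    obtain ⟨hωs, hbr⟩ := Zd.mem_bridges.1 hωb
    have h0 : ω 0 = 0 := (Zd.mem_saws.1 hωs).1
    refine ⟨coBridge_mem_sawFun (Zd.mem_sawFun_iff_mem_saws.2 ⟨hωs, hωn⟩), fun i _ => ?_⟩
    obtain ⟨htube, hc⟩ := hcone (n - i) (Nat.sub_le n i)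
    have h16 := sixteen_mul_abs_le hκ htube
    have ha := abs_nonneg (ω (n - i) 1)
    have hx0 : 0 ≤ ω (n - i) 0 := by
      rcases Nat.eq_zero_or_pos (n - i) with hz | hpos
      · rw [hz, h0]; exact le_rfl
      · have := (hbr (n - i) hpos (Nat.sub_le n i)).1
        rw [h0] at this
        exact le_of_lt this
    rw [sub_zero] at hc
    simp only [Pi.sub_apply, Matrix.cons_val_zero, Matrix.cons_val_one, zero_sub, abs_neg]
    omega
  · intro ω hω ω' hω' hφ
    rw [Finset.mem_coe, Finset.mem_filter] at hω hω'
    have hωs := Zd.mem_saws.1 (Zd.mem_bridges.1 hω.1).1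
    have hω's := Zd.mem_saws.1 (Zd.mem_bridges.1 hω'.1).1
    funext j
    rcases le_or_gt j n with hj | hj
    · have e := congrFun hφ (n - j)
      have e' : ![(s : ℤ), 0] - ω (n - (n - j)) = ![(s : ℤ), 0] - ω' (n - (n - j)) := e
      rwa [show n - (n - j) = j by omega, sub_right_inj] at e'
    · rw [hωs.2.1 j hj.le, hω's.2.1 j hj.le, hω.2.1, hω'.2.1]

/-- **Second half: cone bridges directly.**  The cone-bridge mass at `(s, 0)` is at most the mass of
self-avoiding walks `0 → (s, 0)` confined by the END-cone site predicate "`x > 0` or the origin; `4|y| ≤ s − x`;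
`16|y| ≤ s + 16`" (a bridge has `x > x(0) = 0` after time `0`). -/
theorem coneMass_le_endConeMass {κ : ℝ} (hκ : κ ≤ 1 / 4) (s : ℕ) {t : ℤ} (ht : t = 0) (N : ℕ) :
    (∑ n ∈ Finset.range (N + 1),
      ∑ _ω ∈ (Zd.bridges 2 n).filter (fun ω => ω n = ![(s : ℤ), t] ∧
          ∀ i ≤ n, |((ω i 1 : ℤ) : ℝ) - (t : ℝ) / (s : ℝ) * ((ω i 0 : ℤ) : ℝ)| ≤ κ * s / 4 + 1 ∧
            4 * |ω i 1 - t| ≤ (s : ℤ) - ω i 0),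
        criticalFugacity ^ n) ≤
      ∑ n ∈ Finset.range (N + 1),
        ∑ _ω ∈ (Zd.sawFun 2 n ![(s : ℤ), 0]).filter (fun ω => ∀ i ≤ n,
            (0 < ω i 0 ∨ (ω i 0 = 0 ∧ ω i 1 = 0)) ∧ 4 * |ω i 1| ≤ (s : ℤ) - ω i 0 ∧
              16 * |ω i 1| ≤ (s : ℤ) + 16),
          criticalFugacity ^ n := by
  subst ht
  refine Finset.sum_le_sum fun n _ => Finset.sum_le_sum_of_subset_of_nonneg (fun ω hω => ?_)
    fun _ _ _ => pow_nonneg criticalFugacity_pos.le n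
  rw [Finset.mem_filter] at hω ⊢
  obtain ⟨hωb, hωn, hcone⟩ := hω
  obtain ⟨hωs, hbr⟩ := Zd.mem_bridges.1 hωb
  have h0 : ω 0 = 0 := (Zd.mem_saws.1 hωs).1
  refine ⟨Zd.mem_sawFun_iff_mem_saws.2 ⟨hωs, hωn⟩, fun i hi => ?_⟩
  obtain ⟨htube, hc⟩ := hcone i hi
  have h16 := sixteen_mul_abs_le hκ htube
  rw [sub_zero] at hc
  refine ⟨?_, hc, h16⟩
  rcases Nat.eq_zero_or_pos i with rfl | hpos
  · exact Or.inr ⟨by rw [h0]; rfl, by rw [h0]; rfl⟩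
  · have := (hbr i hpos hi).1
    rw [h0] at this
    exact Or.inl this

/-! ### From the diamond site predicate to diamond pieces -/

/-- A self-avoiding walk `0 → (s, 0)` all of whose points are `(0,0)`, `(s,0)` or strictly inside the diamond
(`|y| < x`, `|y| < s − x`), with `10|y| ≤ s`, is a diamond piece: at interior times `1 ≤ i < n` it is neither
`ω(0) = 0` nor `ω(n) = (s, 0)`. -/
theorem diamondMass_le (s N : ℕ) :
    (∑ n ∈ Finset.range (N + 1),
      ∑ _ω ∈ (Zd.sawFun 2 n ![(s : ℤ), 0]).filter (fun ω => ∀ i ≤ n,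
          ((ω i 0 = 0 ∧ ω i 1 = 0) ∨ (ω i 0 = (s : ℤ) ∧ ω i 1 = 0) ∨
              (|ω i 1| < ω i 0 ∧ |ω i 1| < (s : ℤ) - ω i 0)) ∧ 10 * |ω i 1| ≤ (s : ℤ)),
        criticalFugacity ^ n) ≤
      ∑ n ∈ Finset.range (N + 1),
        ∑ _ω ∈ (SAW.Zd.saws 2 n).filter (fun ω =>
            ω n 0 = (s : ℤ) ∧ ω n 1 = 0 ∧
            (∀ i, 1 ≤ i → i < n → |ω i 1| < ω i 0 ∧ |ω i 1| < (s : ℤ) - ω i 0) ∧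
            (∀ i ≤ n, 10 * |ω i 1| ≤ (s : ℤ))),
          SAW.criticalFugacity ^ n := by
  refine Finset.sum_le_sum fun n _ => Finset.sum_le_sum_of_subset_of_nonneg (fun ω hω => ?_)
    fun _ _ _ => pow_nonneg criticalFugacity_pos.le n
  rw [Finset.mem_filter] at hω ⊢
  obtain ⟨hωF, hR⟩ := hω
  obtain ⟨hωs, hωn⟩ := Zd.mem_sawFun_iff_mem_saws.1 hωF
  obtain ⟨h0, -, -, hinj⟩ := Zd.mem_saws.1 hωs
  refine ⟨hωs, by simp [hωn], by simp [hωn], fun i h1 h2 => ?_, fun i hi => (hR i hi).2⟩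
  rcases (hR i h2.le).1 with ⟨e0, e1⟩ | ⟨e0, e1⟩ | h
  · exfalso
    have he : ω i = ω 0 := by rw [h0]; exact site_ext e0 e1
    have := hinj (show i ≤ n from h2.le) (Nat.zero_le n) he
    omega
  · exfalso
    have he : ω i = ω n := by rw [hωn]; exact site_ext (by simpa using e0) (by simpa using e1)
    have := hinj (show i ≤ n from h2.le) (le_refl n) he
    omega
  · exact h

end ConeToDiamond

/-- **Stub S5 `stub_coneToDiamond` of the line `subcritical-renewal-floor`: `ConeBridgeFloor → DiamondPieceFloor`.**
If cone bridges `0 → (s, t)`, `|t| ≤ κ s` (bridges inside the tube `|y − (t/s)x| ≤ κ s/4 + 1` with the end cone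
`4|y − t| ≤ s − x`) have `x_c`-mass `≥ c s^{−C}` for every `s ≥ 1`, then diamond pieces `0 → (s, 0)` (self-avoiding
walks with interior points in `|y| < min(x, s − x)` and all points in `10|y| ≤ s`) have `x_c`-mass
`≥ min(c², x_c^16) s^{−2 max(C,0)}`: for `s ≥ 16` glue the co-bridge of a cone bridge of span `⌈s/2⌉` and a cone
bridge of span `⌊s/2⌋` (`t = 0`, `κ ≤ 1/4`); for `s < 16` the straight walk. -/
theorem stub_coneToDiamond :
    (∃ κ C c : ℝ, 0 < κ ∧ 0 < c ∧ ∀ (s : ℕ) (t : ℤ), 1 ≤ s → |(t : ℝ)| ≤ κ * s →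
      ∃ N : ℕ, c * (s : ℝ) ^ (-C) ≤ ∑ n ∈ Finset.range (N + 1),
        ∑ _ω ∈ (Zd.bridges 2 n).filter (fun ω => ω n = ![(s : ℤ), t] ∧
            ∀ i ≤ n, |((ω i 1 : ℤ) : ℝ) - (t : ℝ) / (s : ℝ) * ((ω i 0 : ℤ) : ℝ)| ≤ κ * s / 4 + 1 ∧
              4 * |ω i 1 - t| ≤ (s : ℤ) - ω i 0),
          criticalFugacity ^ n) →
    ∃ C c : ℝ, 0 ≤ C ∧ 0 < c ∧ ∀ s : ℕ, 1 ≤ s → ∃ N : ℕ,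
      c * (s : ℝ) ^ (-C) ≤
        ∑ n ∈ Finset.range (N + 1),
          ∑ _ω ∈ (SAW.Zd.saws 2 n).filter (fun ω =>
              ω n 0 = (s : ℤ) ∧ ω n 1 = 0 ∧
              (∀ i, 1 ≤ i → i < n → |ω i 1| < ω i 0 ∧ |ω i 1| < (s : ℤ) - ω i 0) ∧
              (∀ i ≤ n, 10 * |ω i 1| ≤ (s : ℤ))),
            SAW.criticalFugacity ^ n := by
  rintro ⟨κ, C, c, hκ, hc, h⟩
  have hκ4 : κ ≤ 1 / 4 := Negative.coneBridgeFloor_kappa_le hc h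
  have hx0 : 0 < criticalFugacity := criticalFugacity_pos
  have hx1 : criticalFugacity ≤ 1 :=
    inv_le_one_of_one_le₀ (Zd.connectiveConstant_two ▸ Zd.one_le_connectiveConstant 2)
  have hC₀ : 0 ≤ max C 0 := le_max_right _ _
  refine ⟨2 * max C 0, min (c ^ 2) (criticalFugacity ^ 16), by positivity,
    lt_min (pow_pos hc 2) (pow_pos hx0 16), fun s hs => ?_⟩
  have hs1 : (1 : ℝ) ≤ s := by exact_mod_cast hs
  have hsmall : min (c ^ 2) (criticalFugacity ^ 16) * (s : ℝ) ^ (-(2 * max C 0)) ≤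
      min (c ^ 2) (criticalFugacity ^ 16) :=
    mul_le_of_le_one_right (le_min (by positivity) (by positivity))
      (Real.rpow_le_one_of_one_le_of_nonpos hs1 (by linarith))
  rcases lt_or_ge s 16 with hs16 | hs16
  · -- small spans: the straight walk
    refine ⟨s, le_trans ?_ (BridgeDoublingTower.doubling_straight_term s)⟩
    calc min (c ^ 2) (criticalFugacity ^ 16) * (s : ℝ) ^ (-(2 * max C 0))
        ≤ min (c ^ 2) (criticalFugacity ^ 16) := hsmall
      _ ≤ criticalFugacity ^ 16 := min_le_right _ _
      _ ≤ criticalFugacity ^ s := pow_le_pow_of_le_one hx0.le hx1 hs16.le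
  · -- large spans: two halves
    obtain ⟨s₁, s₂, rfl, h8, h21, h12⟩ :
        ∃ s₁ s₂ : ℕ, s = s₁ + s₂ ∧ 8 ≤ s₂ ∧ s₂ ≤ s₁ ∧ s₁ ≤ s₂ + 1 :=
      ⟨s - s / 2, s / 2, by omega, by omega, by omega, by omega⟩
    have ht0 : ∀ m : ℕ, |((0 : ℤ) : ℝ)| ≤ κ * m := fun m => by
      rw [Int.cast_zero, abs_zero]; positivity
    obtain ⟨N₁, hN₁⟩ := h s₁ 0 (by omega) (ht0 s₁)
    obtain ⟨N₂, hN₂⟩ := h s₂ 0 (by omega) (ht0 s₂)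
    have hA := hN₁.trans (ConeToDiamond.coneMass_le_coBridgeMass hκ4 s₁ rfl N₁)
    have hB := hN₂.trans (ConeToDiamond.coneMass_le_endConeMass hκ4 s₂ rfl N₂)
    have hglue := LiebSimonStar.CornerStaircase.tubeMass_concat
      (P := fun p : Site 2 => 0 ≤ p 0 ∧ p 0 ≤ (s₁ : ℤ) ∧ 4 * |p 1| ≤ p 0 ∧ 16 * |p 1| ≤ (s₁ : ℤ) + 16)
      (Q := fun q : Site 2 => (0 < q 0 ∨ (q 0 = 0 ∧ q 1 = 0)) ∧ 4 * |q 1| ≤ (s₂ : ℤ) - q 0 ∧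
        16 * |q 1| ≤ (s₂ : ℤ) + 16)
      (R := fun p : Site 2 => ((p 0 = 0 ∧ p 1 = 0) ∨ (p 0 = ((s₁ + s₂ : ℕ) : ℤ) ∧ p 1 = 0) ∨
          (|p 1| < p 0 ∧ |p 1| < ((s₁ + s₂ : ℕ) : ℤ) - p 0)) ∧ 10 * |p 1| ≤ ((s₁ + s₂ : ℕ) : ℤ))
      (e₁ := ![(s₁ : ℤ), 0]) (e₂ := ![(s₂ : ℤ), 0]) (e := ![((s₁ + s₂ : ℕ) : ℤ), 0])
      (Literature.Probability.Percolation.Contour.site_ext (by simp) (by simp)) ?hP ?hQ ?hsep N₁ N₂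
    case hP =>
      rintro p ⟨h1, h2, h3, h4⟩
      have ha := le_abs_self (p 1)
      have hb := neg_abs_le (p 1)
      push_cast
      constructor <;> omega
    case hQ =>
      rintro q ⟨hq, h2, h3⟩
      have ha := le_abs_self (q 1)
      have hb := neg_abs_le (q 1)
      simp only [Pi.add_apply, Matrix.cons_val_zero, Matrix.cons_val_one, zero_add]
      push_cast
      constructor <;> omega
    case hsep =>
      rintro p q ⟨-, h2, -, -⟩ ⟨hq, -, -⟩ h0 -
      simp only [Matrix.cons_val_zero] at h0
      omega
    refine ⟨N₁ + N₂, le_trans ?_ (hglue.trans (ConeToDiamond.diamondMass_le (s₁ + s₂) (N₁ + N₂)))⟩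
    -- the floor: `min(c², x_c^16) s^{-2 max(C,0)} ≤ (c s₁^{-C}) (c s₂^{-C})`
    have hspos : (0 : ℝ) < ((s₁ + s₂ : ℕ) : ℝ) := by positivity
    have key : ∀ m : ℕ, 1 ≤ m → m ≤ s₁ + s₂ →
        ((s₁ + s₂ : ℕ) : ℝ) ^ (-max C 0) ≤ (m : ℝ) ^ (-C) := by
      intro m hm hms
      have hm1 : (1 : ℝ) ≤ m := by exact_mod_cast hm
      calc ((s₁ + s₂ : ℕ) : ℝ) ^ (-max C 0) ≤ (m : ℝ) ^ (-max C 0) :=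
            Real.rpow_le_rpow_of_nonpos (Nat.cast_pos.2 hm) (by exact_mod_cast hms) (by linarith)
        _ ≤ (m : ℝ) ^ (-C) := Real.rpow_le_rpow_of_exponent_le hm1 (neg_le_neg (le_max_left _ _))
    have hAB : c * (s₁ : ℝ) ^ (-C) * (c * (s₂ : ℝ) ^ (-C)) ≤ _ :=
      mul_le_mul hA hB (by positivity) (le_trans (by positivity) hA)
    refine le_trans ?_ hAB
    calc min (c ^ 2) (criticalFugacity ^ 16) * ((s₁ + s₂ : ℕ) : ℝ) ^ (-(2 * max C 0))
        ≤ c ^ 2 * ((s₁ + s₂ : ℕ) : ℝ) ^ (-(2 * max C 0)) :=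
          mul_le_mul_of_nonneg_right (min_le_left _ _) (Real.rpow_nonneg hspos.le _)
      _ = c * ((s₁ + s₂ : ℕ) : ℝ) ^ (-max C 0) * (c * ((s₁ + s₂ : ℕ) : ℝ) ^ (-max C 0)) := by
          rw [show -(2 * max C 0) = -max C 0 + -max C 0 by ring, Real.rpow_add hspos]; ring
      _ ≤ c * (s₁ : ℝ) ^ (-C) * (c * (s₂ : ℝ) ^ (-C)) :=
          mul_le_mul (mul_le_mul_of_nonneg_left (key s₁ (by omega) (by omega)) hc.le)
            (mul_le_mul_of_nonneg_left (key s₂ (by omega) (by omega)) hc.le) (by positivity)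
            (by positivity)

end Summit.CriticalPhenomena.SAWScalingLimit.Theorems.TubeLowerBound.SubcriticalRenewalFloor

end
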